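import Literature.RingTheory.HenselLemma.Factorization
import Mathlib.LinearAlgebra.Matrix.NonsingularInverse
import Mathlib.LinearAlgebra.Matrix.Ideal
import HarnessLib

/-!
# Newton–Hensel iteration for square systems over an adically complete ring (contraction form)

Topic `Literature/RingTheory/HenselLemma`.  The several-variable Hensel lemma in the abstract
"simplified Newton" form in which it is actually used for deformation problems: let `A` be
`I`-adically complete (Mathlib's `IsAdicComplete I A`: Hausdorff and precomplete), `P` any index
type, and `Φ : (P → A) → (P → A)` a self-map of the coordinate space.

* `existsUnique_fixedPoint_of_contracting` — the non-archimedean contraction principle: a map `T`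
  preserving the "ball" `S = {c | ∀ p, c p ∈ I}` and contracting on it
  (`c - c' ∈ I^r ⇒ T c - T c' ∈ I^{r+1}`, coordinatewise) has exactly one fixed point in `S`
  (iterate from `0`, pass to the limit coordinatewise by `IsPrecomplete`, exactness and uniqueness
  by `IsHausdorff`).
* `existsUnique_zero_of_newton` — for `P` finite: if `Φ 0 ∈ S`, and `Φ` admits an *approximate
  derivative* `J ∈ M_P(A)` with `det J` a unit, in the sense that
  `c - c' ∈ I^r ⇒ Φ c - Φ c' - J (c - c') ∈ I^{r+1}` on `S`, then `Φ` has exactly one zero in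
  `S` (apply the contraction principle to `T c = c - J⁻¹ Φ c`).  For a polynomial map this is the
  classical statement "`F(0) ≡ 0`, Jacobian invertible mod `I` ⇒ unique root `≡ 0`" (Bourbaki,
  *Alg. Comm.* III §4 no. 5), but no polynomial structure is required, which is what makes the
  lemma directly applicable to matrix-valued systems such as `N ↦ ((1+N) M (1+N)⁻¹)ᵢⱼ`.
* Bookkeeping on matrices with entries in an ideal (Mathlib's `Ideal.matrix`): products,
  `Matrix.mulVec`, and `1 + N` is invertible with `(1+N)⁻¹ - 1 ∈ M_n(I)` when `N ∈ M_n(I)` and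
  `I ≤ Jac(A)` (e.g. `I` the maximal ideal of a local ring).

Everything is proved; nothing is asserted.
-/

noncomputable section

open Matrix

namespace Literature.RingTheory.HenselLemma

variable {A : Type*} [CommRing A] (I : Ideal A)

/-! ### Entries in an ideal -/

section Entries

variable {I} {n : Type*} [Fintype n] [DecidableEq n]

/-- A matrix with entries in `I`, multiplied on the right by anything, has entries in `I`
(commutative coefficients). [folklore] -/
theorem matrix_mul_mem_of_left {M : Matrix n n A} (hM : M ∈ I.matrix n) (X : Matrix n n A) :
    M * X ∈ I.matrix n := by
  rw [Ideal.mem_matrix] at hM ⊢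
  intro i j
  rw [Matrix.mul_apply]
  exact sum_mem fun l _ => I.mul_mem_right _ (hM i l)

/-- Anything multiplied on the left... : `X * M ∈ M_n(I)` for `M ∈ M_n(I)`. [folklore] -/
theorem matrix_mul_mem_of_right (X : Matrix n n A) {M : Matrix n n A} (hM : M ∈ I.matrix n) :
    X * M ∈ I.matrix n :=
  (I.matrix n).mul_mem_left X hM

/-- `M_n(I) · M_n(J) ⊆ M_n(I J)`. [folklore] -/
theorem matrix_mul_mem_mul {J : Ideal A} {M X : Matrix n n A} (hM : M ∈ I.matrix n)
    (hX : X ∈ J.matrix n) : M * X ∈ (I * J).matrix n := by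
  rw [Ideal.mem_matrix] at hM hX ⊢
  intro i j
  rw [Matrix.mul_apply]
  exact sum_mem fun l _ => Ideal.mul_mem_mul (hM i l) (hX l j)

/-- A three-fold product with the middle factor in `M_n(J)` and an outer factor in `M_n(I)` lies in
`M_n(I J)`. [folklore] -/
theorem matrix_triple_mem_mul_left {J : Ideal A} {X Y : Matrix n n A} (Z : Matrix n n A)
    (hX : X ∈ I.matrix n) (hY : Y ∈ J.matrix n) : X * Y * Z ∈ (I * J).matrix n :=
  matrix_mul_mem_of_left (matrix_mul_mem_mul hX hY) Z

/-- A three-fold product with the middle factor in `M_n(J)` and the right factor in `M_n(I)` lies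
in `M_n(I J)`. [folklore] -/
theorem matrix_triple_mem_mul_right {J : Ideal A} (X : Matrix n n A) {Y Z : Matrix n n A}
    (hY : Y ∈ J.matrix n) (hZ : Z ∈ I.matrix n) : X * Y * Z ∈ (I * J).matrix n := by
  rw [mul_comm I J, Matrix.mul_assoc]
  exact matrix_mul_mem_of_right X (matrix_mul_mem_mul hY hZ)

omit [DecidableEq n] in
/-- `Matrix.mulVec` of a vector with coordinates in `I` has coordinates in `I`. [folklore] -/
theorem mulVec_mem (M : Matrix n n A) {v : n → A} (hv : ∀ j, v j ∈ I) (i : n) :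
    (M *ᵥ v) i ∈ I := by
  rw [Matrix.mulVec, dotProduct]
  exact sum_mem fun j _ => I.mul_mem_left _ (hv j)

/-- `Matrix.mulVec` by a matrix with entries in `I` has coordinates in `I`. [folklore] -/
theorem mulVec_mem_of_matrix {M : Matrix n n A} (hM : M ∈ I.matrix n) (v : n → A) (i : n) :
    (M *ᵥ v) i ∈ I := by
  rw [Ideal.mem_matrix] at hM
  rw [Matrix.mulVec, dotProduct]
  exact sum_mem fun j _ => I.mul_mem_right _ (hM i j)

/-- A matrix congruent to `1` modulo an ideal contained in the Jacobson radical is invertible.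
[folklore] -/
theorem isUnit_det_of_sub_one_mem (hI : I ≤ Ideal.jacobson ⊥) {X : Matrix n n A}
    (hX : X - 1 ∈ I.matrix n) : IsUnit X.det := by
  -- `det X ≡ det 1 = 1 (mod I)`
  have h1 : Ideal.Quotient.mk I X.det = 1 := by
    rw [RingHom.map_det]
    have hmap : (Ideal.Quotient.mk I).mapMatrix X = 1 := by
      ext i j
      rw [RingHom.mapMatrix_apply, Matrix.map_apply]
      have hij : X i j - (1 : Matrix n n A) i j ∈ I := by
        have := (Ideal.mem_matrix n I _).1 hX i j
        rwa [Matrix.sub_apply] at this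
      have hij' : Ideal.Quotient.mk I (X i j) = Ideal.Quotient.mk I ((1 : Matrix n n A) i j) :=
        (Ideal.Quotient.eq).2 hij
      rw [hij']
      by_cases h : i = j
      · subst h; rw [Matrix.one_apply_eq, Matrix.one_apply_eq, map_one]
      · rw [Matrix.one_apply_ne h, Matrix.one_apply_ne h, map_zero]
    rw [hmap, Matrix.det_one]
  have hmem : X.det - 1 ∈ I := by
    rw [← Ideal.Quotient.eq, h1, map_one]
  have hj : X.det - 1 ∈ Ideal.jacobson (⊥ : Ideal A) := hI hmem
  have := Ideal.isUnit_of_sub_one_mem_jacobson_bot (X.det) hj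
  exact this

/-- For `N ∈ M_n(I)` with `I` inside the Jacobson radical, `1 + N` is invertible. [folklore] -/
theorem isUnit_det_one_add (hI : I ≤ Ideal.jacobson ⊥) {N : Matrix n n A} (hN : N ∈ I.matrix n) :
    IsUnit (1 + N).det :=
  isUnit_det_of_sub_one_mem hI (by rwa [add_sub_cancel_left])

/-- For `N ∈ M_n(I)` with `I` inside the Jacobson radical, `(1 + N)⁻¹ - 1 ∈ M_n(I)`
(`(1+N)⁻¹ - 1 = -(1+N)⁻¹ N`). [folklore] -/
theorem inv_one_add_sub_one_mem (hI : I ≤ Ideal.jacobson ⊥) {N : Matrix n n A}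
    (hN : N ∈ I.matrix n) : (1 + N)⁻¹ - 1 ∈ I.matrix n := by
  have hu := isUnit_det_one_add hI hN
  have h : (1 + N)⁻¹ - 1 = -((1 + N)⁻¹ * N) := by
    have h1 : (1 + N)⁻¹ * (1 + N) = 1 := Matrix.nonsing_inv_mul _ hu
    calc (1 + N)⁻¹ - 1 = (1 + N)⁻¹ - (1 + N)⁻¹ * (1 + N) := by rw [h1]
      _ = -((1 + N)⁻¹ * N) := by rw [Matrix.mul_add, Matrix.mul_one]; abel
  rw [h]
  exact neg_mem (matrix_mul_mem_of_right _ hN)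

end Entries

/-! ### The contraction principle -/

section FixedPoint

variable {I} {P : Type*}

variable (I)

/-- **Non-archimedean contraction principle.**  Let `A` be `I`-adically complete and
`T : (P → A) → (P → A)` a map preserving `S = {c | ∀ p, c p ∈ I}` which is contracting on `S`
coordinatewise: `c - c' ∈ I^r` implies `T c - T c' ∈ I^{r+1}`.  Then `T` has exactly one fixed
point in `S` (the limit of the iterates of `0`). [folklore] -/
theorem existsUnique_fixedPoint_of_contracting [IsAdicComplete I A] (T : (P → A) → (P → A))
    (hT₀ : ∀ c : P → A, (∀ p, c p ∈ I) → ∀ p, T c p ∈ I)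
    (hT : ∀ (r : ℕ) (c c' : P → A), (∀ p, c p ∈ I) → (∀ p, c' p ∈ I) →
      (∀ p, c p - c' p ∈ I ^ r) → ∀ p, T c p - T c' p ∈ I ^ (r + 1)) :
    ∃! c : P → A, (∀ p, c p ∈ I) ∧ T c = c := by
  -- the iterates of `0`
  let x : ℕ → P → A := fun r => T^[r] 0
  have hx0 : x 0 = 0 := rfl
  have hxs : ∀ r, x (r + 1) = T (x r) := fun r => Function.iterate_succ_apply' T r 0
  have hxI : ∀ r p, x r p ∈ I := by
    intro r
    induction r with
    | zero => intro p; rw [hx0]; exact I.zero_mem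
    | succ r ih => intro p; rw [hxs]; exact hT₀ _ ih p
  have hstep : ∀ r p, x (r + 1) p - x r p ∈ I ^ (r + 1) := by
    intro r
    induction r with
    | zero =>
      intro p
      rw [hxs, hx0, zero_add, pow_one, Pi.zero_apply, sub_zero]
      exact hT₀ 0 (fun _ => I.zero_mem) p
    | succ r ih =>
      intro p
      have e : x (r + 1 + 1) p - x (r + 1) p = T (x (r + 1)) p - T (x r) p := by
        rw [← hxs (r + 1), ← hxs r]
      rw [e]
      exact hT (r + 1) _ _ (hxI _) (hxI _) ih p
  have hcauchy : ∀ p m n, m ≤ n → x n p - x m p ∈ I ^ m := by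
    intro p m n hmn
    induction n, hmn using Nat.le_induction with
    | base => rw [sub_self]; exact Ideal.zero_mem _
    | succ n hmn ih =>
      have : x (n + 1) p - x m p = (x (n + 1) p - x n p) + (x n p - x m p) := by ring
      rw [this]
      exact add_mem (Ideal.pow_le_pow_right (by omega) (hstep n p)) ih
  -- coordinatewise limit
  have hlim : ∀ p, ∃ L : A, ∀ r, x r p - L ∈ I ^ r := by
    intro p
    obtain ⟨L, hL⟩ := IsPrecomplete.prec' (I := I) (fun r => x r p) (fun {m n} hmn =>
      (smodEq_smul_top_iff _ _ _).mpr (by rw [← neg_sub]; exact neg_mem (hcauchy p m n hmn)))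
    exact ⟨L, fun r => (smodEq_smul_top_iff _ _ _).mp (hL r)⟩
  choose c hc using hlim
  have hcI : ∀ p, c p ∈ I := by
    intro p
    have : c p = x 1 p - (x 1 p - c p) := by ring
    rw [this]
    exact sub_mem (hxI 1 p) (by simpa only [pow_one] using hc p 1)
  have hfix : T c = c := by
    funext p
    rw [← sub_eq_zero]
    refine IsHausdorff.haus' (I := I) _ fun r => (smodEq_smul_top_iff _ _ _).mpr ?_
    rw [sub_zero]
    have : T c p - c p = (T c p - T (x r) p) + (x (r + 1) p - c p) := by rw [hxs]; ring
    rw [this]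
    refine add_mem (Ideal.pow_le_pow_right (Nat.le_succ r) ?_)
      (Ideal.pow_le_pow_right (Nat.le_succ r) (hc p (r + 1)))
    refine hT r c (x r) hcI (hxI r) (fun q => ?_) p
    rw [← neg_sub]
    exact neg_mem (hc q r)
  refine ⟨c, ⟨hcI, hfix⟩, ?_⟩
  -- uniqueness
  rintro c' ⟨hc'I, hfix'⟩
  funext p
  rw [← sub_eq_zero]
  refine IsHausdorff.haus' (I := I) _ fun r => (smodEq_smul_top_iff _ _ _).mpr ?_
  rw [sub_zero]
  revert p
  induction r with
  | zero => intro p; rw [pow_zero, Ideal.one_eq_top]; exact Submodule.mem_top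
  | succ r ih =>
    intro p
    have e : c' p - c p = T c' p - T c p := by rw [hfix, hfix']
    rw [e]
    exact hT r c' c hc'I hcI ih p

/-! ### Newton–Hensel for square systems -/

variable [Fintype P] [DecidableEq P]

/-- **Newton–Hensel iteration (several variables, contraction form).**  Let `A` be `I`-adically
complete, `P` finite, `Φ : (P → A) → (P → A)` with `Φ 0 ∈ I^P`, and `J ∈ M_P(A)` with `det J` a
unit such that, for `c, c'` with coordinates in `I`, `c - c' ∈ I^r` coordinatewise implies
`Φ c - Φ c' - J (c - c') ∈ I^{r+1}` coordinatewise ("`J` is the derivative of `Φ` modulo `I`").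
Then `Φ` has exactly one zero with coordinates in `I`.  (Bourbaki, *Alg. Comm.* III §4 no. 5 for
restricted power series; here `T c = c - J⁻¹ Φ c` is contracting and one applies
`existsUnique_fixedPoint_of_contracting`.) [folklore] -/
theorem existsUnique_zero_of_newton [IsAdicComplete I A] (Φ : (P → A) → (P → A))
    (J : Matrix P P A) (hJ : IsUnit J.det) (h0 : ∀ p, Φ 0 p ∈ I)
    (hΦ : ∀ (r : ℕ) (c c' : P → A), (∀ p, c p ∈ I) → (∀ p, c' p ∈ I) →
      (∀ p, c p - c' p ∈ I ^ r) → ∀ p, (Φ c - Φ c' - J *ᵥ (c - c')) p ∈ I ^ (r + 1)) :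
    ∃! c : P → A, (∀ p, c p ∈ I) ∧ Φ c = 0 := by
  have hJJ : J⁻¹ * J = 1 := Matrix.nonsing_inv_mul J hJ
  have hJJ' : J * J⁻¹ = 1 := Matrix.mul_nonsing_inv J hJ
  let T : (P → A) → (P → A) := fun c => c - J⁻¹ *ᵥ Φ c
  -- `Φ` maps `S` into `S`
  have hΦS : ∀ c : P → A, (∀ p, c p ∈ I) → ∀ p, Φ c p ∈ I := by
    intro c hc p
    have h := hΦ 0 c 0 hc (fun _ => I.zero_mem)
      (fun q => by rw [pow_zero, Ideal.one_eq_top]; exact Submodule.mem_top) p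
    rw [zero_add, pow_one, sub_zero, Pi.sub_apply, Pi.sub_apply] at h
    have : Φ c p = (Φ c - Φ 0 - J *ᵥ c) p + Φ 0 p + (J *ᵥ c) p := by
      simp only [Pi.sub_apply]; ring
    rw [this]
    exact add_mem (add_mem h (h0 p)) (mulVec_mem J hc p)
  have hfix_iff : ∀ c : P → A, T c = c ↔ Φ c = 0 := by
    intro c
    constructor
    · intro h
      have h' : J⁻¹ *ᵥ Φ c = 0 := by
        have := congrArg (fun y => c - y) h
        simpa [T] using this
      have := congrArg (fun y => J *ᵥ y) h'
      simpa only [Matrix.mulVec_mulVec, hJJ', Matrix.one_mulVec, Matrix.mulVec_zero] using this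
    · intro h
      simp [T, h]
  obtain ⟨c, ⟨hcI, hcT⟩, huniq⟩ := existsUnique_fixedPoint_of_contracting I T
    (fun c hc p => sub_mem (hc p) (mulVec_mem _ (hΦS c hc) p))
    (fun r c c' hc hc' hcc' p => by
      have hT : T c - T c' = -(J⁻¹ *ᵥ (Φ c - Φ c' - J *ᵥ (c - c'))) := by
        simp only [T, Matrix.mulVec_sub, Matrix.mulVec_mulVec, hJJ, Matrix.one_mulVec]
        abel
      have := congrFun hT p
      rw [Pi.sub_apply] at this
      rw [this, Pi.neg_apply]
      exact neg_mem (mulVec_mem _ (hΦ r c c' hc hc' hcc') p))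
  refine ⟨c, ⟨hcI, (hfix_iff c).1 hcT⟩, ?_⟩
  rintro c' ⟨hc'I, hc'Φ⟩
  exact huniq c' ⟨hc'I, (hfix_iff c').2 hc'Φ⟩

omit [Fintype P] [DecidableEq P] in
/-- **Functoriality of the Newton–Hensel zero** (uniqueness transported along a ring map): if
`f : A → B` maps `I` into `I'`, `c` is a zero of `Φ` with coordinates in `I`, `Φ'` over `B` has at
most one zero with coordinates in `I'`, `c'` is such a zero, and `Φ' (f ∘ c) = f ∘ Φ c`, then
`f ∘ c = c'`. [folklore] -/
theorem map_zero_eq_of_unique {B : Type*} [CommRing B] (I' : Ideal B) (f : A →+* B)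
    (hf : ∀ a ∈ I, f a ∈ I') {Φ : (P → A) → (P → A)} {Φ' : (P → B) → (P → B)}
    {c : P → A} (hc : ∀ p, c p ∈ I) (hΦc : Φ c = 0) (hcomm : Φ' (f ∘ c) = f ∘ Φ c)
    (huniq : ∀ d d' : P → B, (∀ p, d p ∈ I') → Φ' d = 0 → (∀ p, d' p ∈ I') → Φ' d' = 0 → d = d')
    {c' : P → B} (hc' : ∀ p, c' p ∈ I') (hΦc' : Φ' c' = 0) : f ∘ c = c' :=
  huniq _ _ (fun p => hf _ (hc p)) (by rw [hcomm, hΦc]; funext p; exact map_zero f) hc' hΦc'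

end FixedPoint

end Literature.RingTheory.HenselLemma
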